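import Summits.CriticalPhenomena.PercolationContinuityZ3.Theorems.Transplant.BoxProdZ2Defs
import Summits.CriticalPhenomena.PercolationContinuityZ3.Theorems.Transplant.BoxProdSubexponential
import Summits.CriticalPhenomena.PercolationContinuityZ3.Theorems.Transplant.BSConj4BoxProdZ2OfSkeletonNode
import HarnessLib
import HarnessLib.Audit

/-!
# The lane's ONE named missing theorem for products, `SamePWitnessBoxProdZ2`, and the assembly
# `continuity_boxProdZ2 : (tubes subcritical at p_c) → SamePWitnessBoxProdZ2 → BSConj4_boxProdZ2`

builds on p205010 (kernel theorem, internal audit signed; external expert review pending).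
Status sentence (coordinator 2026-08-20T04:30Z): "θ(p_c) = 0 on ℤ^d, all d ≥ 2 — kernel-verified (Lean 4/Mathlib,
standard axioms); internal adversarial audit SIGNED 2026-08-20 04:29Z; external expert review pending."

Resubmission of p209559 after a gate commit-lock failure (2026-08-20T06:48Z); the exponential-growth case is now the lead's
`bsConj4_boxProdZ2_case_expGrowth` (`BSConj4BoxProdZ2OfSkeletonNode.lean`, imported, not restated).
Lane `prim-bschramm-*`, seat `prim-bschramm-stmt` (lead request 2026-08-20T06:33Z "Φ0-prod", FILE 2; FILE 1 = the lead's
`Transplant/BoxProdZ2Defs.lean`: `SameP.SamePWitnessAt`, `BoxProdZ2.tube`, `BoxProdZ2.TubeSubcritical`).  Design references: `LADDER.md` v4,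
`BLUEPRINT-I-PHI.md` §6 (the product re-typing of Kozma–Nitzan §4) — a DESIGN, refereed at design level, NOT a theorem.

* `SamePWitnessBoxProdZ2` (`@[conjecture]`, OPEN, never asserted; NOT in print) — **the named missing theorem of rung R2c / Φ-2**: for an
  infinite, connected, locally finite, quasi-transitive, amenable `X`, a root `(w,0)` and a density `p` at which (i) the infinite cluster of
  `X □ ℤ²` is a.s. unique, (ii) no tube `X × {-ℓ,…,ℓ}²` percolates and (iii) `θ_{(w,0)}(p) > 0`, there is a same-`p` witness
  `SameP.SamePWitnessAt (X □ zdGraph 2) (w,0) p` (a lawful bounded-envelope history scheme at the ONE density `p` forcing `(w,0) ↔ ∞`).  This is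
  Kozma–Nitzan's §4 (Lemmas 7–12 + the exploration scheme) re-typed in product coordinates with near-one gluing supplied by the tree's
  `AdditiveGluing` (p205010, status sentence above) — which is why `AdditiveGluing`/Conjecture 3 is NOT a hypothesis here.
* PROVED around it (with the lead's `bsConj4_boxProdZ2_case_expGrowth`: Hutchcroft covers every `X` of exponential growth, amenable or not):
  `isGraphAmenable_of_not_hasExponentialGrowth` (tree contrapositive), `bsConj4_boxProdZ2_of_subexponential_case` (the product target reduces
  to `X` of subexponential growth), and the ASSEMBLY `continuity_boxProdZ2`: given tube-subcriticality at `p_c(X □ ℤ²)` for the relevant `X`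
  (p3's deliverable via Martineau–Severo, tree device p208012) and `SamePWitnessBoxProdZ2`, Benjamini–Schramm's Conjecture 4 holds for EVERY
  `X □ ℤ²` with `X` infinite, connected, locally finite, quasi-transitive (`BSConj4_boxProdZ2`).  Ingredients all kernel-checked: exponential-growth
  case (Hutchcroft 2016, tree), `p_c < 1`, uniqueness for subexponential `X` (Burton–Keane, p3's `numInfiniteClusters_le_one_boxProd_zdGraph`,
  p209276), the continuation principle at the single density `p_c` (`SameP.theta_criticalProbIOf_eq_zero_of_samePWitnessAt`, lead/p4).
  `continuity_boxProdZ2_of_tubeSubcritical` is the same with tube-subcriticality asked only for subexponential `X`.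
[cite: KozmaNitzan2024, §4 (pp. 15–25)] [cite: BenjaminiSchramm1996, Conj. 4] [cite: Hutchcroft2016, Thm. 1] [cite: MartineauSevero2019, Cor. 2.2]
-/

noncomputable section

namespace Summit.CriticalPhenomena.PercolationContinuityZ3.Theorems.Transplant

open MeasureTheory Literature.Probability.Percolation Literature.Probability.LatticeModels
open Literature.Barriers.CriticalPhenomena (IsQuasiTransitive IsGraphAmenable HasExponentialGrowth hasExponentialGrowth_of_not_isGraphAmenable
  countable_of_connected_of_locallyFinite)

/-! ## The conjecture node -/

/-- TARGET (OPEN — a `Prop`, never asserted; NOT in print): **same-`p` witnesses on `X □ ℤ²` — Kozma–Nitzan §4 re-typed for products.**  For every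
infinite, connected, locally finite, quasi-transitive, amenable graph `X`, every `w` and every density `p`: if the infinite cluster of Bernoulli(`p`)
bond percolation on `X □ ℤ²` is a.s. unique, no tube `X × {-ℓ,…,ℓ}²` percolates at `p` (`BoxProdZ2.TubeSubcritical X p`), and
`θ_{(w,0)}(p) > 0`, then there is a lawful bounded-envelope history-driven renormalisation scheme at the single density `p` whose infinite
macro-cluster forces `(w,0) ↔ ∞` (`SameP.SamePWitnessAt`).  The lane's ONE named missing theorem for rung R2c / Φ-2 (design `BLUEPRINT-I-PHI.md`
§6; near-one gluing is the tree's `AdditiveGluing`, hence not a hypothesis) — builds on p205010 (kernel theorem, internal audit signed; external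
expert review pending). [cite: KozmaNitzan2024, §4 (Lemmas 7–12 and the exploration process, pp. 15–25)] -/
@[conjecture] def SamePWitnessBoxProdZ2 : Prop :=
  ∀ {W : Type} [DecidableEq W] (X : SimpleGraph W) [X.LocallyFinite], X.Connected → IsQuasiTransitive X → IsGraphAmenable X →
    Infinite W → ∀ (w : W) (p : unitInterval),
      (∀ᵐ ω ∂(bondPercolation (X □ zdGraph 2) p), numInfiniteClusters ω ≤ 1) → BoxProdZ2.TubeSubcritical X p →
        0 < theta (X □ zdGraph 2) (w, (0 : Site 2)) p → SameP.SamePWitnessAt (X □ zdGraph 2) (w, (0 : Site 2)) p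

/-! ## The growth dichotomy: exponential growth is Hutchcroft's case (lead's `bsConj4_boxProdZ2_case_expGrowth`), subexponential growth is amenable -/

/-- A quasi-transitive locally finite graph of subexponential growth is amenable (contrapositive of the tree's
`hasExponentialGrowth_of_not_isGraphAmenable`, Lyons–Peres §6.1). [cite: LyonsPeres2016, §6.1 (p. 279)] -/
theorem isGraphAmenable_of_not_hasExponentialGrowth {W : Type} [DecidableEq W] (X : SimpleGraph W) [X.LocallyFinite]
    (hq : IsQuasiTransitive X) (hg : ¬ HasExponentialGrowth X) : IsGraphAmenable X := by
  by_contra h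
  exact hg (hasExponentialGrowth_of_not_isGraphAmenable X hq h)

/-- **PROVED CASE SPLIT on growth — the product target reduces to `X` of SUBEXPONENTIAL growth** (such `X` are amenable; the exponential case is
Hutchcroft's theorem). [cite: Hutchcroft2016, Thm. 1] [cite: BenjaminiSchramm1996, Conj. 4] -/
theorem bsConj4_boxProdZ2_of_subexponential_case
    (h : ∀ {W : Type} [DecidableEq W] (X : SimpleGraph W) [X.LocallyFinite], X.Connected → IsQuasiTransitive X → ¬ HasExponentialGrowth X →
      Infinite W → ∀ w : W, theta (X □ zdGraph 2) (w, (0 : Site 2)) (criticalProbIOf (X □ zdGraph 2) (w, (0 : Site 2))) = 0) :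
    BSConj4_boxProdZ2 := by
  intro W X _ hc hq hinf w
  classical
  by_cases hg : HasExponentialGrowth X
  · exact bsConj4_boxProdZ2_case_expGrowth X hc hq hg w
  · exact h X hc hq hg hinf w

/-! ## Assembly -/

/-- **ASSEMBLY (subexponential tube hypothesis)**: if for every infinite, connected, locally finite, quasi-transitive `X` of subexponential growth
no tube `X × {-ℓ,…,ℓ}²` percolates at `p_c(X □ ℤ²)`, then `SamePWitnessBoxProdZ2` implies Benjamini–Schramm's Conjecture 4 for every product
`X □ ℤ²` (`X` infinite, connected, locally finite, quasi-transitive).  Uses: the growth dichotomy, uniqueness of the infinite cluster on `X □ ℤ²`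
for subexponential `X` at every `p` (Burton–Keane, p3's `numInfiniteClusters_le_one_boxProd_zdGraph`), and the continuation principle at the
single density `p_c` (`SameP.theta_criticalProbIOf_eq_zero_of_samePWitnessAt`) — builds on p205010 (kernel theorem, internal audit signed;
external expert review pending). [cite: KozmaNitzan2024, §1 p. 2 (approach 1)] [cite: BurtonKeane1989, Thm. 2] [cite: Hutchcroft2016, Thm. 1] -/
theorem continuity_boxProdZ2_of_tubeSubcritical
    (hT : ∀ {W : Type} [DecidableEq W] (X : SimpleGraph W) [X.LocallyFinite], X.Connected → IsQuasiTransitive X → ¬ HasExponentialGrowth X →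
      Infinite W → ∀ w : W, BoxProdZ2.TubeSubcritical X (criticalProbIOf (X □ zdGraph 2) (w, (0 : Site 2))))
    (hS : SamePWitnessBoxProdZ2) : BSConj4_boxProdZ2 := by
  refine bsConj4_boxProdZ2_of_subexponential_case fun {W} _ X _ hc hq hg hinf w => ?_
  have ha : IsGraphAmenable X := isGraphAmenable_of_not_hasExponentialGrowth X hq hg
  haveI : Countable (W × Site 2) := countable_of_connected_of_locallyFinite (X □ zdGraph 2) (connected_boxProd_zdGraph hc 2) (w, 0)
  exact SameP.theta_criticalProbIOf_eq_zero_of_samePWitnessAt (X □ zdGraph 2) (w, 0) fun hθ =>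
    hS X hc hq ha hinf w _ (numInfiniteClusters_le_one_boxProd_zdGraph X hc hq hg 2 _) (hT X hc hq hg hinf w) hθ

/-- **ASSEMBLY (lead's form, amenable tube hypothesis)**: if for every infinite, connected, locally finite, quasi-transitive, AMENABLE `X` and every
`w` no tube percolates at `p_c(X □ ℤ²)` (p3's deliverable `tubeSubcritical_criticalProb`, Martineau–Severo device p208012), then
`SamePWitnessBoxProdZ2 → BSConj4_boxProdZ2`: **Benjamini–Schramm's Conjecture 4 for EVERY `X □ ℤ²` (`X` infinite connected locally finite
quasi-transitive) follows from ONE named conjecture node** — exponential-growth case, `p_c < 1`, uniqueness, the continuation principle and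
near-one gluing being kernel theorems; builds on p205010 (kernel theorem, internal audit signed; external expert review pending).
[cite: KozmaNitzan2024, §1 p. 2 (approach 1)] [cite: MartineauSevero2019, Cor. 2.2] [cite: BenjaminiSchramm1996, Conj. 4] -/
theorem continuity_boxProdZ2
    (hT : ∀ {W : Type} [DecidableEq W] (X : SimpleGraph W) [X.LocallyFinite], X.Connected → IsQuasiTransitive X → IsGraphAmenable X →
      Infinite W → ∀ w : W, BoxProdZ2.TubeSubcritical X (criticalProbIOf (X □ zdGraph 2) (w, (0 : Site 2))))
    (hS : SamePWitnessBoxProdZ2) : BSConj4_boxProdZ2 :=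
  continuity_boxProdZ2_of_tubeSubcritical
    (fun X _ hc hq hg hinf w => hT X hc hq (isGraphAmenable_of_not_hasExponentialGrowth X hq hg) hinf w) hS

end Summit.CriticalPhenomena.PercolationContinuityZ3.Theorems.Transplant
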